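import Literature.Analysis.FluidPDE.NSLerayRegularisedExistence
import Literature.Analysis.FluidPDE.NSRegFourierHalfLine
import Literature.Analysis.FluidPDE.NSRegFourierDatum
import Literature.Analysis.FluidPDE.LeraySeparationOfEnergy
import HarnessLib

/-!
# Discharge of `leray_regularised_wellposed` (Leray 1934, Ch. V §§26–27)

Proof file of `Literature/Analysis/FluidPDE/NSLerayRegularisedExistence`: the named fact
`Literature.Analysis.FluidPDE.leray_regularised_wellposed` — global well-posedness of the
Leray-regularised Navier–Stokes problem `∂ₜu − νΔu + ((J_χu)·∇)u + ∇p = 0`, `div u = 0`,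
`u(0) = J_χ u₀` on `ℝ³` for every bump kernel `χ` and every weakly divergence-free `u₀ ∈ L²`, with
the energy equality and the `χ`-uniform separation of energy (Leray 1934, Acta Math. 63, Ch. V,
§26 pp. 231–232 and §27 pp. 232–235, (5.1)–(5.7); Ożański–Pooley 2018, Thm. 6.33 and Lemma 6.34;
Robinson–Rodrigo–Sadowski 2016, Thm. 14.1 / Prop. 14.3) — is proved
(`leray_regularised_wellposed_holds`) by assembling the tree's two halves of Leray's §§26–27:

* **§26, the global regular solution** (Fourier side, `NSRegFourier*`): the datum
  `a = 𝓕⁻¹(J_χ u₀)` with the hypotheses of the global construction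
  (`FourierNS.exists_fourierDatum`, `NSRegFourierDatum`), the global mild solution by uniform
  restarts of the Picard scheme (`NSRegFourierGlobal`), its synthesis as a classical solution of the
  drift system with the energy equality, Leray's regularised weak form, `Ju = J_χ u` and the
  pressure bound `‖p‖₂ ≤ 9‖|J_χu||u|‖₂` (`FourierNS.exists_global_regularised_fields`,
  `NSRegFourierHalfLine`);
* **§27, la répartition de l'énergie cinétique à grande distance** (physical side,
  `LeraySeparationOfEnergy`): for every finite-energy classical solution of the drift system with
  Leray's subordination of drift and pressure (`LerayTailHyp`: `‖J_χu‖_q ≤ ‖u‖_q` by Young,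
  `‖p‖₂ ≤ C_p‖|J_χu||u|‖₂`), `∫_{|x|>R₂}|u(t)|² ≤ ∫_{|x|>R₁}|u(0)|² + C(M³t^{1/4} + M²√t)/(R₂ − R₁)`
  for `M ≥ ‖u(0)‖₂`, with `C = C(ν)` — here `M = ‖u₀‖₂ ≥ ‖J_χ u₀‖₂`, so the tail constant
  `C̄(M, t) = C (M³ t^{1/4} + M² t^{1/2})` is uniform in `χ` and quantified before the kernel, as the
  fact demands (Leray: "Ces résultats devront être indépendants de `ε`").

## References

* J. Leray, *Sur le mouvement d'un liquide visqueux emplissant l'espace*, Acta Math. 63 (1934),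
  Ch. V §26 (pp. 231–232), §27 (pp. 232–235, (5.2)–(5.7)). [Leray1934]
* W. S. Ożański, B. C. Pooley, *Leray's fundamental work on the Navier–Stokes equations: a modern
  review*, LMS Lecture Note Ser. 452 (CUP 2018) = arXiv:1708.09787, Def. 6.32, Thm. 6.33,
  Lemma 6.34, (6.77)–(6.86). [OzanskiPooley2018]
* J. C. Robinson, J. L. Rodrigo, W. Sadowski, *The three-dimensional Navier–Stokes equations*
  (CUP 2016), Thm. 14.1, Prop. 14.3. [RobinsonRodrigoSadowski2016]
-/

noncomputable section

open MeasureTheory TopologicalSpace Set Function Filter Topology Real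
open scoped InnerProductSpace RealInnerProductSpace ENNReal NNReal Laplacian Convolution FourierTransform

namespace Literature.Analysis.FluidPDE

open FourierNS.ClayDatum (reVec reVec_apply)

/-- **Leray 1934, Ch. V §§26–27: global well-posedness of the regularised problem with the energy
equality and the `ε`-uniform separation of energy** — discharge of the named fact
`leray_regularised_wellposed` (Ożański–Pooley 2018, Thm. 6.33 and Lemma 6.34;
Robinson–Rodrigo–Sadowski 2016, Thm. 14.1, Prop. 14.3). Real proof: the Fourier-side global
regular solution (`FourierNS.exists_fourierDatum`, `FourierNS.exists_global_regularised_fields`)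
and the physical-space separation of energy (`exists_leray_separation_of_energy'`, pressure
constant `C_p = 9`, `M = ‖u₀‖₂`). [cite: Leray1934, Ch. V §§26–27, pp. 231–235, (5.1)–(5.7)] -/
theorem leray_regularised_wellposed_holds : leray_regularised_wellposed := by
  intro ν hν
  -- the tail constant of the separation of energy, uniform in the kernel and the datum
  have hE : Module.finrank ℝ (EuclideanSpace ℝ (Fin 3)) = 3 := by simp
  obtain ⟨C, -, hC⟩ := exists_leray_separation_of_energy' (E := EuclideanSpace ℝ (Fin 3)) hE hν ((Fintype.card (Fin 3) ^ 2 : ℕ) : ℝ≥0)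
  refine ⟨fun M t => C * (M ^ 3 * t ^ (1 / 4 : ℝ) + M ^ 2 * t ^ (1 / 2 : ℝ)), ?_⟩
  intro χ u₀ hu₀ hdiv
  -- the Fourier datum `a = 𝓕⁻¹ (J_χ u₀)` and the global regularised solution
  have hK : Fintype.card (Fin 3) < 2 * 2 := by simp
  have hc : 0 < 4 * π ^ 2 * ν := by positivity
  obtain ⟨a, ha, hall, haF⟩ := FourierNS.exists_fourierDatum χ hu₀ hdiv hc hK
  obtain ⟨u, w, p, hsol, h0, hw, hcont, hdiss, henergy, hweak, hpress⟩ :=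
    FourierNS.exists_global_regularised_fields hν ha hall
  -- the datum is attained: `u 0 = J_χ u₀`
  have hinit : u 0 = mollify χ u₀ := by
    funext x
    rw [h0 x]
    ext l
    rw [reVec_apply, haF x l, Complex.ofReal_re]
  -- the hypotheses of the separation of energy
  have htail : LerayTailHyp ν ((Fintype.card (Fin 3) ^ 2 : ℕ) : ℝ≥0) w u p :=
    { solution := isClassicalDriftNSSolutionOn_Ioi_of_Icc hsol
      continuousInL2 := hcont
      dissipation_lt_top := hdiss
      energy_le := fun s t hs hst => le_of_eq (henergy s t hs hst)
      drift_two := fun t ht => by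
        rw [hw t ht.le]
        exact eLpNorm_mollify_le χ (hcont.1 t ht.le).1
      drift_four := fun t ht => by
        rw [hw t ht.le]
        exact FunctionSpaces.eLpNorm_normed_convolution_le χ (hcont.1 t ht.le).1 (by norm_num)
      pressure_two := fun t ht => hpress t ht.le }
  refine ⟨u, contDiffOn_one_Ioi_of_Icc (fun T hT => (hsol T hT).smooth_velocity), hcont,
    fun t ht => (hsol t ht).divFree t ⟨ht.le, le_rfl⟩, hweak, hdiss, henergy, ?_, hinit⟩
  -- the separation of energy with `M = ‖u₀‖₂ ≥ ‖J_χ u₀‖₂ = ‖u 0‖₂`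
  intro R₁ R₂ t hR₁ hR ht
  have hM0 : 0 ≤ (eLpNorm u₀ 2 volume).toReal := ENNReal.toReal_nonneg
  have hM : eLpNorm (u 0) 2 volume ≤ ENNReal.ofReal (eLpNorm u₀ 2 volume).toReal := by
    rw [ENNReal.ofReal_toReal hu₀.eLpNorm_ne_top, hinit]
    exact eLpNorm_mollify_le χ hu₀.aestronglyMeasurable
  exact hC htail hM0 hM R₁ R₂ t hR₁ hR ht

end Literature.Analysis.FluidPDE

end
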